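import Mathlib
import HarnessLib
import Summits.HubbardSuperconductivity.HubbardSuperconductivity.Theorems.KLProgrammeKLRegimeEngineTowerBlockStepWtOriented
import Summits.HubbardSuperconductivity.HubbardSuperconductivity.Theorems.KLProgrammeKLRegimeEngineTowerBlockStepLev
import Summits.HubbardSuperconductivity.HubbardSuperconductivity.Theorems.KLProgrammeKLRegimeEngineTowerLevBridge
import Summits.HubbardSuperconductivity.HubbardSuperconductivity.Theorems.KLProgrammeKLRegimeEngineTowerLevBridgeSwSigma
import Summits.HubbardSuperconductivity.HubbardSuperconductivity.Theorems.KLProgrammeKLRegimeEngineTowerBlockCovOverlap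
import Summits.HubbardSuperconductivity.HubbardSuperconductivity.Theorems.KLProgrammeKLRegimeEngineTowerBlockIncrWt
import Summits.HubbardSuperconductivity.HubbardSuperconductivity.Theorems.KLProgrammeKLRegimeEngineTowerBlockIncrLevKit

/-!
# «(ℓ)-LEV-DOOR-INST» — the ORIENTED levelled block-step door ON THE TOWER'S OWN INCREMENT, instantiation items (I1)(I2) discharged
# (crux K3 ENGINE, stmt-HubbardSuperconductivity-20437 `KLRegimeEngineV17F2`, stub (b) v2, levels package (ℓ), cure of located item #10 «(ℓ)-LEV-ODD»;
#  cell gate-hubbard-kl, seat hubbard-kl-k3c3-p2 g15 — E1 / the LINK-F lane may rename or supersede)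

k3c2-p3's oriented door `EngineV8.blockStep_ordersGe2_wtOriented_le` (the Literature oriented plateau door at the block geometry,
orientation oracle discharged) is stated for ANY even input `G`, ANY tree weight and leaves to the tower three instantiation data (I):
(I1) the talking relation `ov` of the coarse sector legs with its count `c` and `hCov`; (I2) the full-pin / position-only-pin input
families `B`, `B′`; (I3) the levelled majorant `Nl ≤ Bm·θ^{lumps}`.  This file applies it — together with E1's first-order levelled door
`blockStep_firstOrder_lev_le` — to the tower's own block: input `G := klTowerInput … d k = 𝒱_{dk}` (even, no constant part when
`Z^K_{Λ_{dk}} ≠ 0`), slice `Γ = C^K_{(Λ_{d(k+1)}, Λ_{dk}]}`, input family `F_{dk−1}`, output `Δ_k = klTowerIncr … d k` read at `F_{J′}`,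
`J′ ≥ dk`, in the UNWEIGHTED levelled currency (tree weight `1`, `IsTreeWeight.const_one`), with

* (I1) DISCHARGED: `ov σ σ′ := ∃ q, F̃ σ.1.1 q · F̃ σ′.1.1 q ≠ 0`, `c = 36` (`card_filter_overlap_bgmFat_sectorLeg_le`,
  `hCov_bgmFat_hubbardCovSliceCT` of `…TowerBlockCovOverlap`);
* (I2) DISCHARGED: `B m′ Fc := klTowerMeasLev … d k (2m′) Fc` (`doorInput_klTowerInput_le_klTowerMeasLev`), and the position-only family
  `B′ m′ 0 := |SectorLeg (sectorCount (dk−1))| · klTowerMeasLev … (2m′) 0`, `B′ m′ (F₀+1) := klTowerMeasLev … (2m′) F₀`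
  (`swSigmaInput_klTowerInput_levelZero_le`, `swSigmaInput_klTowerInput_le_klTowerMeasLev` — spacetime translation invariance of `𝒱_{dk}`);
* (I3) KEPT as hypotheses on an abstract levelled majorant `Nl` (`hBN`, the level-`0` row `hB'N0`, `hanti`, `hdom`) — the F-law's floor
  units dictionary, owner LINK-F.

* §1 `towerBsw` rows — the position-only family and its two defining inequalities;
* §2 **`doorSum_klTowerIncr_le_oriented`** — for every pinned output leg `p`, prescribed output legs `J ∌ p` with labels `τ″` and pin `w″`,
  the door-form sum `Σ_{X″ : X″ p = w″, (X″ j).2 = τ″ j ∀ j ∈ J} ‖kernel (map E(F_{J′})) Δ_k (2q+2) X″‖` is at most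
  (oriented orders-≥2 right side with line constant `36·α` and profile functional `(∏ Bm(δ a))·θ^{lumps (1+|J|)}`) + (first-order
  binomial-prescribed right side charging `27^{|J|}·ε·klTowerMeasLev … (2m′) |J|`).
Compositions of landed theorems; nothing about the model is asserted beyond them; nothing asserts (ℓ), any stub, K3 or superconductivity.
References: BGM 2006 §2.7 (2.66), (2.70)–(2.71a), §2.8 (2.76)–(2.84), (2.88)–(2.90), (2.97)–(2.98), App. A3, App. A4 (A4.5)–(A4.8)
[cite: BenfattoGiulianiMastropietro2006].
-/

noncomputable section

namespace Summit.HubbardSuperconductivity.HubbardSuperconductivity.Theorems.EngineV8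

set_option linter.dupNamespace false -- summit = problem name (single-conjunct summit), D-0017

open Classical
open Real Finset Literature.MathematicalPhysics.QuantumLattice Literature.Probability.LatticeModels GrassmannAlgebra
open Literature.MathematicalPhysics.QuantumLattice.FermiRG Literature.MathematicalPhysics.QuantumLattice.FermiRG.BGM2006Routing
open Summit.HubbardSuperconductivity.HubbardSuperconductivity.Theorems.KLProgrammeLegKernels
open Summit.HubbardSuperconductivity.HubbardSuperconductivity.Theorems.KLRegimeSplit
open Summit.HubbardSuperconductivity.HubbardSuperconductivity.Theorems.KLRegimeWick
open Summit.HubbardSuperconductivity.HubbardSuperconductivity.Theorems.TwoPointAssembly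
open Literature.Probability.LatticeModels.BattleFederbush
open scoped Nat

variable {L M : ℕ} [NeZero L] [NeZero M]

/-! ## §1 The position-only input family of the tower -/

omit [NeZero M] in
/-- **The position-only-pin input family of block `k`** read from the measured levelled arrays: at level `0` the whole sector alphabet
times the level-`0` array, at level `F₀ + 1` the array ONE LEVEL LOWER (the pinned leg's sector is summed, its position is immaterial by
translation invariance). Spelled as a lambda in the statements below; this row is its level-`0` value. -/
theorem towerBsw_zero (β U μ : ℝ) (K : TrigPolyC4v) (d k m : ℕ) :
    (fun m Fc : ℕ => if Fc = 0 then (Fintype.card (SectorLeg (sectorCount (d * k - 1))) : ℝ) * klTowerMeasLev L M β U μ K d k (2 * m) 0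
      else klTowerMeasLev L M β U μ K d k (2 * m) (Fc - 1)) m 0 =
      (Fintype.card (SectorLeg (sectorCount (d * k - 1))) : ℝ) * klTowerMeasLev L M β U μ K d k (2 * m) 0 := by
  simp only [if_true]

omit [NeZero M] in
/-- The position-only family at a successor level is the measured array one level lower. -/
theorem towerBsw_succ (β U μ : ℝ) (K : TrigPolyC4v) (d k m F₀ : ℕ) :
    (fun m Fc : ℕ => if Fc = 0 then (Fintype.card (SectorLeg (sectorCount (d * k - 1))) : ℝ) * klTowerMeasLev L M β U μ K d k (2 * m) 0
      else klTowerMeasLev L M β U μ K d k (2 * m) (Fc - 1)) m (F₀ + 1) = klTowerMeasLev L M β U μ K d k (2 * m) F₀ := by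
  simp only [Nat.succ_ne_zero, if_false, Nat.add_sub_cancel]

/-- **(I2), position-only pin**: for `t ∉ E`, `|E| = Fc`, ANY choice `yσ` of the pinned position as a function of the pinned leg's sector,
the unweighted swapped input sum of `𝒱_{dk}` at `F_{dk−1}` in degree `2m′+2` is at most the position-only family at `(m′+1, Fc)` (`0 < β`). -/
theorem swInput_klTowerInput_le_towerBsw {β : ℝ} (hβ : 0 < β) (U μ : ℝ) (K : TrigPolyC4v) (d k : ℕ) (m' Fc : ℕ)
    (E : Finset (Fin (2 * m' + 1 + 1))) (τ : Fin (2 * m' + 1 + 1) → SectorLeg (sectorCount (d * k - 1))) (t : Fin (2 * m' + 1 + 1))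
    (hE : E.card = Fc) (yσ : SectorLeg (sectorCount (d * k - 1)) → SpaceTimeIdx L M) :
    imagTimeWeight β M ^ (2 * m' + 1) *
        ∑ σ ∈ univ.filter (fun σ : Fin (2 * m' + 1 + 1) → SectorLeg (sectorCount (d * k - 1)) => ∀ e ∈ E, σ e = τ e),
          ∑ x ∈ univ.filter (fun x : Fin (2 * m' + 1 + 1) → SpaceTimeIdx L M => x t = yσ (σ t)),
            ‖sectorisedKernel L M β (klAnisoFamily L M β μ K klE0 (d * k - 1)) (klTowerInput L M β U μ K d k) (2 * m' + 1 + 1) σ x‖ ≤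
      (fun m Fc : ℕ => if Fc = 0 then (Fintype.card (SectorLeg (sectorCount (d * k - 1))) : ℝ) * klTowerMeasLev L M β U μ K d k (2 * m) 0
        else klTowerMeasLev L M β U μ K d k (2 * m) (Fc - 1)) (m' + 1) Fc := by
  have h2 : 2 * (m' + 1) = 2 * m' + 1 + 1 := by ring
  rcases Fc with _ | F₀
  · rw [towerBsw_zero, h2]
    exact swSigmaInput_klTowerInput_levelZero_le hβ.le U μ K d k E τ t hE yσ
  · rw [towerBsw_succ, h2]
    exact swSigmaInput_klTowerInput_le_klTowerMeasLev hβ U μ K d k E τ t hE yσ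

/-! ## §2 The oriented block step on the tower's own increment, door form -/

/-- **THE ORIENTED LEVELLED BLOCK STEP ON `Δ_k`, DOOR FORM, (I1)(I2) DISCHARGED.**  `1 ≤ d`, `1 ≤ k`, `dk ≤ J′`, `Z^K_{Λ_{dk}} ≠ 0`; UNWEIGHTED
block constants (Gram `κ`, rows/cols `α` of `S(F̃)ᵀΓS(F̃)`, radius `ρ`, overlap `(cr, cc)` of `E(F_{J′})·S(F̃)`, truncation `N₀ ≥ 2`); an
abstract levelled majorant `Nl ≥ 0`, antitone in the level, dominating the measured levelled input arrays one level up
(`ε·klTowerMeasLev … (2(m′+1)) Fc ≤ Nl (m′+1) (Fc+1)`) and the level-`0` position-only row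
(`ε·|SectorLeg|·klTowerMeasLev … (2(m′+1)) 0 ≤ Nl (m′+1) 0`), itself dominated by `Bm m′ · θ^{lumps L}` for `L ≥ 1`; the door guard
`e·α·normV(ε·klTowerMeasLev … (2m′) 0)/κ² < 1`.  Then for every pinned output leg `p`, prescribed output legs `J ∌ p`, labels `τ″` and pin
`w″`, the door-form sum of `‖kernel (map E(F_{J′})) Δ_k (2q+2) ·‖` is at most the oriented orders-≥2 right side (line constant `36·α`,
profile functional `(∏ Bm (δ a))·θ^{lumps (1+|J|)}`) plus the first-order binomial-prescribed right side. -/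
theorem doorSum_klTowerIncr_le_oriented {β : ℝ} (hβ : 0 < β) (U μ : ℝ) (K : TrigPolyC4v) {d k J' : ℕ} (hd : 1 ≤ d) (hk : 1 ≤ k)
    (hJ' : d * k ≤ J') (hZ : hubbardEffPartitionFnCT L M β U μ 0 K (klScale klE0 (d * k)) ≠ 0)
    {κ : ℝ} (hκ : 0 < κ)
    (hGB : IsGramBoundedR ((sectorSubMatrix L M β (bgmFatMultiplier L M klE0 β (nambuXiCT L μ K) (d * k - 1))).transpose *
      hubbardCovSliceCT L M β μ 0 K (klScale klE0 (d * (k + 1))) (klScale klE0 (d * k)) *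
        sectorSubMatrix L M β (bgmFatMultiplier L M klE0 β (nambuXiCT L μ K) (d * k - 1))) κ)
    {α : ℝ} (hα : 0 < α)
    (hrow : ∀ X, ∑ Y, ‖((sectorSubMatrix L M β (bgmFatMultiplier L M klE0 β (nambuXiCT L μ K) (d * k - 1))).transpose *
        hubbardCovSliceCT L M β μ 0 K (klScale klE0 (d * (k + 1))) (klScale klE0 (d * k)) *
          sectorSubMatrix L M β (bgmFatMultiplier L M klE0 β (nambuXiCT L μ K) (d * k - 1))) X Y‖ ≤ α)
    (hcol : ∀ Y, ∑ X, ‖((sectorSubMatrix L M β (bgmFatMultiplier L M klE0 β (nambuXiCT L μ K) (d * k - 1))).transpose *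
        hubbardCovSliceCT L M β μ 0 K (klScale klE0 (d * (k + 1))) (klScale klE0 (d * k)) *
          sectorSubMatrix L M β (bgmFatMultiplier L M klE0 β (nambuXiCT L μ K) (d * k - 1))) X Y‖ ≤ α)
    {ρ : ℝ} (hρ : 0 < ρ)
    {cr cc : ℝ} (hcc0 : 0 ≤ cc)
    (hrow' : ∀ X'', ∑ X', ‖(sectorAnalysisMatrix L M β (klAnisoFamily L M β μ K klE0 J') *
        sectorSubMatrix L M β (bgmFatMultiplier L M klE0 β (nambuXiCT L μ K) (d * k - 1))) X'' X'‖ ≤ cr)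
    (hcol' : ∀ X', ∑ X'', ‖(sectorAnalysisMatrix L M β (klAnisoFamily L M β μ K klE0 J') *
        sectorSubMatrix L M β (bgmFatMultiplier L M klE0 β (nambuXiCT L μ K) (d * k - 1))) X'' X'‖ ≤ cc)
    {N₀ : ℕ} (hN₀ : 2 ≤ N₀)
    (Nl : ℕ → ℕ → ℝ) (hNl0 : ∀ m' Lv, 0 ≤ Nl m' Lv) (hanti : ∀ m' Lv Lv', Lv ≤ Lv' → Nl m' Lv' ≤ Nl m' Lv)
    (hBN : ∀ m' Fc, imagTimeWeight β M * klTowerMeasLev L M β U μ K d k (2 * (m' + 1)) Fc ≤ Nl (m' + 1) (Fc + 1))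
    (hB'N0 : ∀ m', imagTimeWeight β M * ((Fintype.card (SectorLeg (sectorCount (d * k - 1))) : ℝ) *
      klTowerMeasLev L M β U μ K d k (2 * (m' + 1)) 0) ≤ Nl (m' + 1) 0)
    (Bm : ℕ → ℝ) (hBm0 : ∀ m', 0 ≤ Bm m') {θ : ℝ} (hθ0 : 0 ≤ θ) (hdom : ∀ m' Lv, 1 ≤ Lv → Nl m' Lv ≤ Bm m' * θ ^ lumps Lv)
    (hθV : Real.exp 1 * α * normV (SpaceTimeIdx L M × SectorLeg (sectorCount (d * k - 1))) κ ρ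
      (fun m' => imagTimeWeight β M * klTowerMeasLev L M β U μ K d k (2 * m') 0) / κ ^ 2 < 1)
    {q : ℕ} (p : Fin (2 * q + 1 + 1)) (J : Finset (Fin (2 * q + 1 + 1))) (hp : p ∉ J)
    (τ'' : Fin (2 * q + 1 + 1) → SectorLeg (sectorCount J')) (w'' : SpaceTimeIdx L M × SectorLeg (sectorCount J')) :
    ∑ X'' ∈ univ.filter (fun X'' : Fin (2 * q + 1 + 1) → SpaceTimeIdx L M × SectorLeg (sectorCount J') =>
        X'' p = w'' ∧ ∀ j ∈ J, (X'' j).2 = τ'' j),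
        ‖kernel ℂ (ExteriorAlgebra.map (Matrix.toLin' (sectorAnalysisMatrix L M β (klAnisoFamily L M β μ K klE0 J')))
          (klTowerIncr L M β U μ K d k)) (2 * q + 1 + 1) X''‖ ≤
      cr * cc ^ (2 * q + 1) * ((∏ j ∈ J, (((univ.filter fun ℓ' : SectorLeg (sectorCount (d * k - 1)) =>
          (∃ q' : FreqMomentum L M, klAnisoFamily L M β μ K klE0 J' (τ'' j).1.1 q' ≠ 0 ∧
            bgmFatMultiplier L M klE0 β (nambuXiCT L μ K) (d * k - 1) ℓ'.1.1 q' ≠ 0) ∧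
          ℓ'.1.2 = (τ'' j).1.2 ∧ ℓ'.2 = (τ'' j).2).card : ℕ) : ℝ)) *
        (∑ n ∈ Ico 2 N₀, (κ⁻¹ ^ (2 * q + 1 + 1) * κ⁻¹ ^ (2 * (n - 1)) * ((((36 : ℕ) : ℝ) * α) ^ (n - 1) * Real.exp n)) *
            ∑ δ ∈ (Fintype.piFinset fun _ : Fin n => range (Fintype.card (SpaceTimeIdx L M × SectorLeg (sectorCount (d * k - 1))) / 2 + 1)) with
                2 * q + 1 + 1 + 2 * (n - 1) ≤ ∑ a, 2 * δ a,
              ∑ pf : J → Fin n, ((∏ j, ((2 * δ (pf j) : ℕ) : ℝ)) / ((∑ a, 2 * δ a : ℕ) : ℝ) ^ J.card) *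
                ((Real.exp 3 * κ) ^ (∑ a, 2 * δ a) * ((∏ a, Bm (δ a)) * θ ^ lumps (1 + J.card))) +
          ρ⁻¹ ^ (2 * q + 1 + 1) * (Real.exp 1 * normV (SpaceTimeIdx L M × SectorLeg (sectorCount (d * k - 1))) κ ρ
              (fun m' => imagTimeWeight β M * klTowerMeasLev L M β U μ K d k (2 * m') 0)) *
            (Real.exp 1 * α * normV (SpaceTimeIdx L M × SectorLeg (sectorCount (d * k - 1))) κ ρ
                (fun m' => imagTimeWeight β M * klTowerMeasLev L M β U μ K d k (2 * m') 0) / κ ^ 2) ^ (N₀ - 1) /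
            (1 - Real.exp 1 * α * normV (SpaceTimeIdx L M × SectorLeg (sectorCount (d * k - 1))) κ ρ
                (fun m' => imagTimeWeight β M * klTowerMeasLev L M β U μ K d k (2 * m') 0) / κ ^ 2))) +
      cr * cc ^ (2 * q + 1) *
        ∑ m' ∈ range (Fintype.card (SpaceTimeIdx L M × SectorLeg (sectorCount (d * k - 1))) / 2 + 1), (if q + 1 < m' then
          ((((2 * (q + 1)).factorial : ℝ))⁻¹ * ((∏ j ∈ univ.filter (fun j : Fin (2 * (q + 1)) => j ∉ J), (2 * m' - (j : ℕ)) : ℕ) : ℝ)) *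
            ((2 * m' : ℕ) : ℝ) ^ J.card * κ ^ (2 * m' - 2 * (q + 1)) *
              ((27 : ℝ) ^ J.card * (imagTimeWeight β M * klTowerMeasLev L M β U μ K d k (2 * m') J.card)) else 0) := by
  have hβ' : β ≠ 0 := hβ.ne'
  have hJ₁ : 1 ≤ d * k := le_trans hd (Nat.le_mul_of_pos_right d hk)
  have hJ : d * k ≤ d * (k + 1) := Nat.mul_le_mul_left d (Nat.le_succ k)
  have hG : klTowerInput L M β U μ K d k ∈ evenPart ℂ (HubbardFieldIdx L M) := klEffectiveAction_mem_evenPart hβ' U μ K klE0 (d * k)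
  have hG0 : constPart ℂ (klTowerInput L M β U μ K d k) = 0 := constPart_klEffectiveAction_eq_zero β U μ K klE0 (d * k) hZ
  -- the input families: measured levelled arrays (full pin) and the position-only family
  set B : ℕ → ℕ → ℝ := fun m c => klTowerMeasLev L M β U μ K d k (2 * m) c with hB
  set B' : ℕ → ℕ → ℝ := fun m Fc => if Fc = 0 then
      (Fintype.card (SectorLeg (sectorCount (d * k - 1))) : ℝ) * klTowerMeasLev L M β U μ K d k (2 * m) 0
    else klTowerMeasLev L M β U μ K d k (2 * m) (Fc - 1) with hB'
  have hB0 : ∀ m c, 0 ≤ B m c := fun m c => klTowerMeasLev_nonneg hβ.le U μ K d k _ c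
  have hBin : ∀ (m' Fc : ℕ) (E : Finset (Fin (2 * m' + 1 + 1))) (τ' : Fin (2 * m' + 1 + 1) → SectorLeg (sectorCount (d * k - 1)))
      (q' : Fin (2 * m' + 1 + 1)), q' ∈ E → E.card = Fc + 1 → ∀ y : SpaceTimeIdx L M,
        imagTimeWeight β M ^ (2 * m' + 1) *
          ∑ σ ∈ univ.filter (fun σ : Fin (2 * m' + 1 + 1) → SectorLeg (sectorCount (d * k - 1)) => ∀ e ∈ E, σ e = τ' e),
            ∑ x ∈ univ.filter (fun x : Fin (2 * m' + 1 + 1) → SpaceTimeIdx L M => x q' = y),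
              ‖sectorisedKernel L M β (klAnisoFamily L M β μ K klE0 (d * k - 1)) (klTowerInput L M β U μ K d k) (2 * m' + 1 + 1) σ x‖ ≤
          B (m' + 1) Fc :=
    fun m' Fc E τ' q' hq hE y => doorInput_klTowerInput_le_klTowerMeasLev hβ.le U μ K d k m' Fc E τ' q' hq hE y
  -- the weighted (weight `1`) forms of the two input rows
  have hBw : ∀ (m' Fc : ℕ) (E : Finset (Fin (2 * m' + 1 + 1))) (τ' : Fin (2 * m' + 1 + 1) → SectorLeg (sectorCount (d * k - 1)))
      (q' : Fin (2 * m' + 1 + 1)), q' ∈ E → E.card = Fc + 1 → ∀ y : SpaceTimeIdx L M,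
        imagTimeWeight β M ^ (2 * m' + 1) *
          ∑ σ ∈ univ.filter (fun σ : Fin (2 * m' + 1 + 1) → SectorLeg (sectorCount (d * k - 1)) => ∀ e ∈ E, σ e = τ' e),
            ∑ x ∈ univ.filter (fun x : Fin (2 * m' + 1 + 1) → SpaceTimeIdx L M => x q' = y),
              (fun _ : Finset Unit => (1 : ℝ)) ((univ.image fun i => (x i, σ i)).image (fun _ => ())) *
              ‖sectorisedKernel L M β (klAnisoFamily L M β μ K klE0 (d * k - 1)) (klTowerInput L M β U μ K d k) (2 * m' + 1 + 1) σ x‖ ≤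
          B (m' + 1) Fc := fun m' Fc E τ' q' hq hE y => by
    simpa only [one_mul] using hBin m' Fc E τ' q' hq hE y
  have hB'w : ∀ (m' Fc : ℕ) (E : Finset (Fin (2 * m' + 1 + 1))) (τ' : Fin (2 * m' + 1 + 1) → SectorLeg (sectorCount (d * k - 1)))
      (t : Fin (2 * m' + 1 + 1)), t ∉ E → E.card = Fc → ∀ yσ : SectorLeg (sectorCount (d * k - 1)) → SpaceTimeIdx L M,
        imagTimeWeight β M ^ (2 * m' + 1) *
          ∑ σ ∈ univ.filter (fun σ : Fin (2 * m' + 1 + 1) → SectorLeg (sectorCount (d * k - 1)) => ∀ e ∈ E, σ e = τ' e),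
            ∑ x ∈ univ.filter (fun x : Fin (2 * m' + 1 + 1) → SpaceTimeIdx L M => x t = yσ (σ t)),
              (fun _ : Finset Unit => (1 : ℝ)) ((univ.image fun i => (x i, σ i)).image (fun _ => ())) *
              ‖sectorisedKernel L M β (klAnisoFamily L M β μ K klE0 (d * k - 1)) (klTowerInput L M β U μ K d k) (2 * m' + 1 + 1) σ x‖ ≤
          B' (m' + 1) Fc := fun m' Fc E τ' t _ hE yσ => by
    simpa only [one_mul] using swInput_klTowerInput_le_towerBsw hβ U μ K d k m' Fc E τ' t hE yσ
  -- (I3) rows for the position-only family from `hBN` and the level-`0` row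
  have hB'N : ∀ m' Fc, imagTimeWeight β M * B' (m' + 1) Fc ≤ Nl (m' + 1) Fc := by
    intro m' Fc
    rcases Fc with _ | F₀
    · rw [hB', towerBsw_zero]; exact hB'N0 m'
    · rw [hB', towerBsw_succ]; exact hBN m' F₀
  have hBN' : ∀ m' Fc, imagTimeWeight β M * B (m' + 1) Fc ≤ Nl (m' + 1) (Fc + 1) := fun m' Fc => hBN m' Fc
  -- (I1): the talking relation with `c = 36`
  have h36 : (1 : ℕ) ≤ 36 := by norm_num
  -- the weight-`1` rows/cols
  have hroww : ∀ X, ∑ Y, ‖((sectorSubMatrix L M β (bgmFatMultiplier L M klE0 β (nambuXiCT L μ K) (d * k - 1))).transpose *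
        hubbardCovSliceCT L M β μ 0 K (klScale klE0 (d * (k + 1))) (klScale klE0 (d * k)) *
          sectorSubMatrix L M β (bgmFatMultiplier L M klE0 β (nambuXiCT L μ K) (d * k - 1))) X Y‖ *
        (fun _ : Finset Unit => (1 : ℝ)) {(fun _ : SpaceTimeIdx L M × SectorLeg (sectorCount (d * k - 1)) => ()) X,
          (fun _ : SpaceTimeIdx L M × SectorLeg (sectorCount (d * k - 1)) => ()) Y} ≤ α := fun X => by
    simpa only [mul_one] using hrow X
  have hcolw : ∀ Y, ∑ X, ‖((sectorSubMatrix L M β (bgmFatMultiplier L M klE0 β (nambuXiCT L μ K) (d * k - 1))).transpose *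
        hubbardCovSliceCT L M β μ 0 K (klScale klE0 (d * (k + 1))) (klScale klE0 (d * k)) *
          sectorSubMatrix L M β (bgmFatMultiplier L M klE0 β (nambuXiCT L μ K) (d * k - 1))) X Y‖ *
        (fun _ : Finset Unit => (1 : ℝ)) {(fun _ : SpaceTimeIdx L M × SectorLeg (sectorCount (d * k - 1)) => ()) X,
          (fun _ : SpaceTimeIdx L M × SectorLeg (sectorCount (d * k - 1)) => ()) Y} ≤ α := fun Y => by
    simpa only [mul_one] using hcol Y
  have hrow'w : ∀ X'', ∑ X', ‖(sectorAnalysisMatrix L M β (klAnisoFamily L M β μ K klE0 J') *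
        sectorSubMatrix L M β (bgmFatMultiplier L M klE0 β (nambuXiCT L μ K) (d * k - 1))) X'' X'‖ *
        (fun _ : Finset Unit => (1 : ℝ)) {(fun _ : SpaceTimeIdx L M × SectorLeg (sectorCount J') => ()) X'',
          (fun _ : SpaceTimeIdx L M × SectorLeg (sectorCount (d * k - 1)) => ()) X'} ≤ cr := fun X'' => by
    simpa only [mul_one] using hrow' X''
  have hcol'w : ∀ X', ∑ X'', ‖(sectorAnalysisMatrix L M β (klAnisoFamily L M β μ K klE0 J') *
        sectorSubMatrix L M β (bgmFatMultiplier L M klE0 β (nambuXiCT L μ K) (d * k - 1))) X'' X'‖ *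
        (fun _ : Finset Unit => (1 : ℝ)) {(fun _ : SpaceTimeIdx L M × SectorLeg (sectorCount J') => ()) X'',
          (fun _ : SpaceTimeIdx L M × SectorLeg (sectorCount (d * k - 1)) => ()) X'} ≤ cc := fun X' => by
    simpa only [mul_one] using hcol' X'
  -- a default sector of the input alphabet
  obtain ⟨σdef⟩ : Nonempty (SectorLeg (sectorCount (d * k - 1))) := ⟨((⟨0, sectorCount_pos _⟩, 0), 0)⟩
  -- the two doors at this `(p, J, τ″, w″)`
  have h2 := blockStep_ordersGe2_wtOriented_le (L := L) (M := M) (IsTreeWeight.const_one (Λ := Unit)) hβ μ K hJ₁ hJ hJ'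
    (fun _ : SpaceTimeIdx L M × SectorLeg (sectorCount (d * k - 1)) => ())
    (fun _ : SpaceTimeIdx L M × SectorLeg (sectorCount J') => ())
    (klTowerInput L M β U μ K d k) hG hG0 σdef
    (fun σ σ' : SectorLeg (sectorCount (d * k - 1)) => ∃ q' : FreqMomentum L M,
      bgmFatMultiplier L M klE0 β (nambuXiCT L μ K) (d * k - 1) σ.1.1 q' *
        bgmFatMultiplier L M klE0 β (nambuXiCT L μ K) (d * k - 1) σ'.1.1 q' ≠ 0)
    h36 (fun σ' => card_filter_overlap_bgmFat_sectorLeg_le (L := L) (M := M) (K := K) (μ := μ) (e₀ := klE0) (β := β) (d * k - 1) σ')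
    (fun X Y hXY => hCov_bgmFat_hubbardCovSliceCT hβ' μ klE0 K _ _ (d * k - 1) X Y hXY)
    hκ hGB B B' hB0 hBw hB'w Nl hNl0 hanti hBN' hB'N Bm hBm0 hθ0 hdom hα hroww hcolw hρ hθV hcc0 hrow'w hcol'w hN₀
    (m := 2 * q + 1) p J hp τ'' w''
  simp only [one_mul] at h2
  have h1 := blockStep_firstOrder_lev_le (L := L) (M := M) hβ μ K hJ₁ hJ hJ' (klTowerInput L M β U μ K d k) hG hκ.le hGB B hB0 hBin hcc0
    hrow' hcol' (q := q) p J hp τ'' w''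
  -- split `Δ_k` inside the door-form sum
  rw [klTowerIncr_eq_ordersGe2_add_firstOrder β U μ K d k hZ, map_add]
  refine le_trans (sum_le_sum fun X _ => ?_) (le_trans (le_of_eq sum_add_distrib) (add_le_add h2 h1))
  rw [kernel_add]
  exact norm_add_le _ _

end Summit.HubbardSuperconductivity.HubbardSuperconductivity.Theorems.EngineV8

end
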